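import Literature.AlgebraicGeometry.RelativeSpec.FiniteGroupQuotientFinsetAffine
import Mathlib.AlgebraicGeometry.Morphisms.IsIso
import HarnessLib

/-!
# Recognising geometric quotients by finite groups: transport along isomorphisms of the target,
# the criterion "`𝒪_Q = (p_*𝒪_X)^G` on an affine cover", and the glued quotient `X → X/G`
# (Mumford, *Abelian Varieties*, §7, Theorem p. 66; SGA 1, Exp. V, §1)

Continuation of `…RelativeSpec.GeometricQuotient` (the predicate `ActionOver.IsGeometricQuotient ρ p`:
Mumford's conditions (1) topological quotient and (2) `𝒪_Q ⥲ (p_*𝒪_X)^G`, with the universal property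
`IsGeometricQuotient.existsUnique_desc`) and `…FiniteGroupQuotientGluing` (the glued quotient
`ActionOver.glued`, `gluedMk : X → X/G`). This file proves:

* `ActionOver.isGeometricQuotient_overMap_iff` — the predicate `IsGeometricQuotient` only depends on the
  automorphisms: the same action viewed over a `G`-invariant `p : X → Q` (`⟨ρ.aut, hp⟩ : ActionOver p G`)
  has the same geometric quotients;
* `IsGeometricQuotient.of_isoTarget` — geometric quotients are stable under isomorphisms of the target;
* `SubringDatum.isIso_fromSpec_of_bijective` — the structure map `Spec_Y(D) → Y` of a relative spectrum is
  an isomorphism as soon as `Γ(Y, U) → D(U)` is bijective on an affine open cover;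
* `ActionOver.isGeometricQuotient_of_range_app` — **recognition**: an AFFINE `G`-invariant `p : X → Q`
  such that, on an affine open cover `{U}` of `Q`, `p♯ : Γ(Q, U) → Γ(X, p⁻¹U)` is injective with image the
  `G`-invariants, IS a geometric quotient (it is then the tree's `X → Spec_Q((p_*𝒪_X)^G) ⥲ Q`,
  `isGeometricQuotient_toQuotient`); and the sections form of a chartwise geometric quotient
  (`injective_app_of_restrict`, `range_app_of_restrict`), whence the affine-cover locality
  `isGeometricQuotient_of_restrict`;
* `ActionOver.isGeometricQuotient_morphismRestrict_gluedMk` — over each chart `O/G ⊆ X/G` the glued quotient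
  map is a geometric quotient, and `ActionOver.isGeometricQuotient_gluedMk` — **for an affine base `Y`,
  `gluedMk : X → X/G` is a geometric quotient** (Mumford's (1) and (2) for the glued `X/G`).

Everything is proved; no named facts and no definitions (theorems only).

Mathlib searched (pin): `IsZariskiLocalAtTarget (MorphismProperty.isomorphisms Scheme)`
(`Morphisms/IsIso`), `isIso_SpecMap_iff`, `MorphismProperty.cancel_left_of_respectsIso`,
`Scheme.Hom.isoOpensRange`, `Scheme.isoOfEq`, `isAffineOpen_opensRange`, `Scheme.Hom.appIso_hom'`
(all used); Mathlib has no quotients of schemes by finite groups.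

## References

* D. Mumford, *Abelian Varieties* (1970), §7, Theorem p. 66 ((1), (2), uniqueness). [MumfordAV1970]
* A. Grothendieck, *SGA 1*, Exp. V, §1, Prop. 1.1, 1.8. [SGA1]
-/

noncomputable section

universe u

open CategoryTheory Limits AlgebraicGeometry Opposite

namespace Literature.AlgebraicGeometry.RelativeSpec

namespace ActionOver

variable {X Y : Scheme.{u}} {r : X ⟶ Y} {G : Type*} [Group G] (ρ : ActionOver r G)

set_option backward.isDefEq.respectTransparency false

/-! ### The action viewed over an invariant morphism -/

/-- Being a geometric quotient only depends on the automorphisms, not on the base over which the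
action is considered: the same action viewed over a `G`-invariant `p : X → Q` (the anonymous
`⟨ρ.aut, hp⟩ : ActionOver p G`, e.g. over a candidate quotient map) has the same geometric
quotients (Mumford's conditions (1), (2) mention only `X`, `G` and `p`). [cite: MumfordAV1970, §7 Thm. p. 66 (1), (2)] -/
theorem isGeometricQuotient_overMap_iff {Q : Scheme.{u}} (p : X ⟶ Q)
    (hp : ∀ g : G, (ρ.aut g).hom ≫ p = p) {Q' : Scheme.{u}} (q : X ⟶ Q') :
    (⟨ρ.aut, hp⟩ : ActionOver p G).IsGeometricQuotient q ↔ ρ.IsGeometricQuotient q :=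
  ⟨fun h => ⟨h.comp_eq, h.surjective, h.isOpenMap, h.exists_aut_apply_eq, h.quasiCompact, h.ker_eq_bot,
      h.exists_app_eq⟩,
    fun h => ⟨h.comp_eq, h.surjective, h.isOpenMap, h.exists_aut_apply_eq, h.quasiCompact, h.ker_eq_bot,
      h.exists_app_eq⟩⟩

/-! ### Stability of geometric quotients under isomorphisms of the target -/

namespace IsGeometricQuotient

variable {ρ} {Q : Scheme.{u}} {p : X ⟶ Q}

/-- **Transport along an isomorphism of the target**: if `p : X → Q` is a geometric quotient and
`e : Q ≅ Q'`, then `p ≫ e` is a geometric quotient ("the pair `(Y, π)` is determined up to an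
isomorphism"). [cite: MumfordAV1970, §7 Thm. p. 66] -/
theorem of_isoTarget {Q' : Scheme.{u}} (h : ρ.IsGeometricQuotient p) (e : Q ≅ Q') :
    ρ.IsGeometricQuotient (p ≫ e.hom) where
  comp_eq g := by rw [← Category.assoc, h.comp_eq]
  surjective := by
    rw [Scheme.Hom.comp_base, TopCat.coe_comp]
    exact e.hom.surjective.comp h.surjective
  isOpenMap := by
    rw [Scheme.Hom.comp_base, TopCat.coe_comp]
    exact e.hom.isOpenEmbedding.isOpenMap.comp h.isOpenMap
  exists_aut_apply_eq {x₁ x₂} hx := by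
    rw [Scheme.Hom.comp_apply, Scheme.Hom.comp_apply] at hx
    exact h.exists_aut_apply_eq (e.hom.isOpenEmbedding.injective hx)
  quasiCompact := haveI := h.quasiCompact; inferInstance
  ker_eq_bot := by
    haveI := h.isSchemeTheoreticallyDominant
    exact IsSchemeTheoreticallyDominant.ker_eq_bot _
  exists_app_eq W s hs := by
    -- `(p ≫ e)⁻¹ W = p⁻¹ (e⁻¹ W)` definitionally
    obtain ⟨t, ht⟩ := h.exists_app_eq (e.hom ⁻¹ᵁ W) s hs
    refine ⟨inv (e.hom.app W) t, ?_⟩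
    rw [Scheme.Hom.comp_app, CommRingCat.comp_apply, ← CommRingCat.comp_apply (inv (e.hom.app W)),
      IsIso.inv_hom_id, CommRingCat.id_apply]
    exact ht

end IsGeometricQuotient

end ActionOver

/-! ### When is `Spec_Y(D) → Y` an isomorphism -/

namespace SubringDatum

variable {X Y : Scheme.{u}} {f : X ⟶ Y} (D : SubringDatum f) [QuasiCompact f] [QuasiSeparated f]

set_option backward.isDefEq.respectTransparency false in
/-- **`Spec_Y(D) → Y` is an isomorphism when `Γ(Y, U) → D(U)` is bijective on an affine open cover**
(then over each such `U` the structure map is `Spec` of an isomorphism; being an isomorphism is local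
on the target): the relative spectrum of `𝒪_Y` itself is `Y`. [cite: StacksProject, Tag 01LQ] -/
theorem isIso_fromSpec_of_bijective {ι : Type*} (U : ι → Y.affineOpens)
    (hU : ⨆ i, (U i : Y.Opens) = ⊤)
    (h : ∀ i, Function.Bijective (D.diagramMap.app (op (U i).1))) : IsIso D.fromSpec := by
  rw [← MorphismProperty.isomorphisms.iff,
    IsZariskiLocalAtTarget.iff_of_iSup_eq_top (P := MorphismProperty.isomorphisms Scheme)
      (fun i => (U i : Y.Opens)) hU]
  intro i
  let e := IsOpenImmersion.isoOfRangeEq (D.fromSpec ⁻¹ᵁ (U i).1).ι (D.openCover.f (U i))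
      (by simpa using congr($(D.fromSpec_preimage (U i)).1))
  rw [← MorphismProperty.cancel_left_of_respectsIso (MorphismProperty.isomorphisms Scheme) e.inv,
    ← MorphismProperty.cancel_right_of_respectsIso (MorphismProperty.isomorphisms Scheme) _
      (U i).2.isoSpec.hom]
  have : (MorphismProperty.isomorphisms Scheme) (Spec.map (D.diagramMap.app (op (U i).1))) := by
    rw [MorphismProperty.isomorphisms.iff, isIso_SpecMap_iff]
    exact h i
  convert! this
  rw [← cancel_mono (U i).2.fromSpec]
  simp [IsAffineOpen.isoSpec_hom, e, ι_fromSpec]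

end SubringDatum

/-! ### Recognition of geometric quotients among affine invariant morphisms -/

namespace ActionOver

variable {X Q : Scheme.{u}} {p : X ⟶ Q} {G : Type*} [Group G] (σ : ActionOver p G)

set_option backward.isDefEq.respectTransparency false

/-- **Recognition, affine over the target.** Let `G` (finite) act on `X` over an AFFINE morphism
`p : X → Q` (i.e. `p` is `G`-invariant). If on an affine open cover `{U}` of `Q` the ring maps
`p♯ : Γ(Q, U) → Γ(X, p⁻¹U)` are injective with image the ring of invariants `Γ(X, p⁻¹U)^G`, then the
structure map `Spec_Q((p_*𝒪_X)^G) → Q` of the tree's quotient is an isomorphism. [cite: MumfordAV1970, §7 Thm. p. 66 (2)] -/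
theorem isIso_quotientToBase_of_range_app [Finite G] [IsAffineHom p] {ι : Type*} (U : ι → Q.affineOpens)
    (hU : ⨆ i, (U i : Q.Opens) = ⊤) (hinj : ∀ i, Function.Injective (p.app (U i).1))
    (hrange : ∀ i, Set.range (p.app (U i).1) = {s | ∀ g : G, σ.act g (U i).1 s = s}) :
    IsIso σ.quotientToBase := by
  refine σ.invariants.isIso_fromSpec_of_bijective U hU fun i => ⟨fun a b hab => ?_, fun y => ?_⟩
  · exact hinj i congr(($hab).1)
  · change ↥(σ.invariantsRing (U i).1) at y
    have hy : y.1 ∈ Set.range (p.app (U i).1) := by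
      rw [hrange i]
      exact fun g => (σ.mem_invariantsRing_iff _ _).mp y.2 g
    obtain ⟨x, hx⟩ := hy
    exact ⟨x, Subtype.ext hx⟩

/-- **Recognition of geometric quotients.** Under the hypotheses of `isIso_quotientToBase_of_range_app`,
`p : X → Q` IS a geometric quotient of `X` by `G`: it is the tree's geometric quotient
`X → Spec_Q((p_*𝒪_X)^G)` (`isGeometricQuotient_toQuotient`) followed by the isomorphism onto `Q`.
[cite: MumfordAV1970, §7 Thm. p. 66] -/
theorem isGeometricQuotient_of_range_app [Finite G] [IsAffineHom p] {ι : Type*} (U : ι → Q.affineOpens)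
    (hU : ⨆ i, (U i : Q.Opens) = ⊤) (hinj : ∀ i, Function.Injective (p.app (U i).1))
    (hrange : ∀ i, Set.range (p.app (U i).1) = {s | ∀ g : G, σ.act g (U i).1 s = s}) :
    σ.IsGeometricQuotient p := by
  haveI := σ.isIso_quotientToBase_of_range_app U hU hinj hrange
  have h := σ.isGeometricQuotient_toQuotient.of_isoTarget (asIso σ.quotientToBase)
  rwa [asIso_hom, toQuotient_quotientToBase] at h

/-! ### Sections of a chartwise geometric quotient -/

section Sections

variable {Y : Scheme.{u}} {r : X ⟶ Y} (ρ : ActionOver r G) (W : Q.Opens)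
  (hW : ∀ g : G, (ρ.aut g).hom ⁻¹ᵁ (p ⁻¹ᵁ W) = p ⁻¹ᵁ W)

/-- **Sections of a chartwise geometric quotient.** If the restriction `p|_{p⁻¹W} : p⁻¹W → W` of a
morphism `p : X → Q` over an open `W ⊆ Q` is a geometric quotient for the restricted action, then
`p♯ : Γ(Q, W) → Γ(X, p⁻¹W)` is injective and its image is the ring of `G`-invariants (Mumford's (2)
read on `W`; the sections of the open subschemes `W`, `p⁻¹W` over `⊤` are those of `Q`, `X` over `W`,
`p⁻¹W`). [cite: MumfordAV1970, §7 Thm. p. 66 (2)] -/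
theorem injective_app_and_range_app_of_restrict
    (h : (ρ.restrict (p ⁻¹ᵁ W) hW).IsGeometricQuotient (p ∣_ W)) :
    Function.Injective (p.app W) ∧
      Set.range (p.app W) =
        {s | ∀ g : G, (ρ.aut g⁻¹).hom.appLE (p ⁻¹ᵁ W) (p ⁻¹ᵁ W) (hW g⁻¹).ge s = s} := by
  -- notation: `ι : p⁻¹W ↪ X`, `B = p⁻¹W`, `T : Γ(X, B) ≅ Γ(p⁻¹W, ⊤)`, `S : Γ(Q, W) ≅ Γ(W, ⊤)`
  let ι : (↑(p ⁻¹ᵁ W) : Scheme.{u}) ⟶ X := (p ⁻¹ᵁ W).ι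
  let B : X.Opens := p ⁻¹ᵁ W
  let O : (↑(p ⁻¹ᵁ W) : Scheme.{u}).Opens := (p ∣_ W) ⁻¹ᵁ ⊤
  have hBO : B = ι ''ᵁ O := by
    change p ⁻¹ᵁ W = (p ⁻¹ᵁ W).ι ''ᵁ (p ∣_ W) ⁻¹ᵁ ⊤
    rw [image_morphismRestrict_preimage, Scheme.Opens.ι_image_top]
  have hOB : O ≤ ι ⁻¹ᵁ B := by rw [hBO, Scheme.Hom.preimage_image_eq]
  let T : Γ(X, B) ⟶ Γ(↑(p ⁻¹ᵁ W), O) := ι.appLE B O hOB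
  haveI : IsIso T := by
    have : T = X.presheaf.map (eqToHom hBO.symm).op ≫ (ι.appIso O).hom := by
      rw [Scheme.Hom.appIso_hom', Scheme.Hom.map_appLE]
    rw [this]
    infer_instance
  have hT : Function.Bijective T := ConcreteCategory.bijective_of_isIso T
  let O' : (↑W : Scheme.{u}).Opens := ⊤
  have hWO : W = W.ι ''ᵁ O' := (Scheme.Opens.ι_image_top W).symm
  have hOW : O' ≤ W.ι ⁻¹ᵁ W := by rw [Scheme.Opens.ι_preimage_self]
  let S : Γ(Q, W) ⟶ Γ(↑W, O') := W.ι.appLE W O' hOW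
  haveI : IsIso S := by
    have : S = Q.presheaf.map (eqToHom hWO.symm).op ≫ (W.ι.appIso O').hom := by
      rw [Scheme.Hom.appIso_hom', Scheme.Hom.map_appLE]
    rw [this]
    infer_instance
  have hS : Function.Bijective S := ConcreteCategory.bijective_of_isIso S
  -- `S ≫ (p|W)♯ = p♯ ≫ T`
  have hcomp : S ≫ (p ∣_ W).app O' = p.app W ≫ T := by
    rw [Scheme.Hom.app_eq_appLE, Scheme.Hom.appLE_comp_appLE, Scheme.Hom.app_eq_appLE]
    change _ = p.appLE W B le_rfl ≫ ι.appLE B O hOB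
    rw [Scheme.Hom.appLE_comp_appLE]
    simp only [Scheme.Hom.appLE, Scheme.Hom.congr_app (morphismRestrict_ι p W), Category.assoc,
      ← Functor.map_comp]
    rfl
  have hcomp' : ∀ a, (p ∣_ W).app O' (S a) = T (p.app W a) := fun a => by
    rw [← CommRingCat.comp_apply, hcomp, CommRingCat.comp_apply]
  -- `T` intertwines the two actions
  have hO : ∀ g : G, O ≤ ρ.restrictHom (p ⁻¹ᵁ W) hW g ⁻¹ᵁ O := fun g => le_top
  have key : ∀ (g : G) (s : Γ(X, B)),
      T ((ρ.aut g⁻¹).hom.appLE B B (hW g⁻¹).ge s) =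
        (ρ.restrictHom (p ⁻¹ᵁ W) hW g⁻¹).appLE O O (hO g⁻¹) (T s) := by
    intro g s
    have hm : ρ.restrictHom (p ⁻¹ᵁ W) hW g⁻¹ ≫ ι = ι ≫ (ρ.aut g⁻¹).hom := ρ.restrictHom_ι _ _ _
    have e : T ≫ (ρ.restrictHom (p ⁻¹ᵁ W) hW g⁻¹).appLE O O (hO g⁻¹) =
        (ρ.aut g⁻¹).hom.appLE B B (hW g⁻¹).ge ≫ T := by
      change ι.appLE B O hOB ≫ _ = _ ≫ ι.appLE B O hOB
      rw [Scheme.Hom.appLE_comp_appLE, Scheme.Hom.appLE_comp_appLE]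
      simp only [Scheme.Hom.appLE, Scheme.Hom.congr_app hm, Category.assoc, ← Functor.map_comp]
      rfl
    have := congrArg (fun φ => φ s) e
    simpa only [CommRingCat.comp_apply] using this.symm
  -- Mumford's (2) on the chart, transported
  have hrange := h.range_app O'
  have hmem : ∀ s : Γ(X, B), T s ∈ Set.range ((p ∣_ W).app O') ↔
      ∀ g : G, (ρ.aut g⁻¹).hom.appLE B B (hW g⁻¹).ge s = s := by
    intro s
    rw [hrange]
    change (∀ g : G, (ρ.restrictHom (p ⁻¹ᵁ W) hW g⁻¹).appLE O O (hO g⁻¹) (T s) = T s) ↔ _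
    refine forall_congr' fun g => ?_
    rw [← key]
    exact hT.1.eq_iff
  refine ⟨fun a b hab => hS.1 (h.app_injective O' ?_), Set.ext fun s => ⟨?_, fun hs => ?_⟩⟩
  · rw [hcomp', hcomp', hab]
  · rintro ⟨a, rfl⟩
    exact (hmem _).mp ⟨S a, hcomp' a⟩
  · obtain ⟨c, hc⟩ := (hmem s).mpr hs
    obtain ⟨a, rfl⟩ := hS.2 c
    exact ⟨a, hT.1 ((hcomp' a).symm.trans hc)⟩

/-- `p♯` is injective over a chart on which `p` restricts to a geometric quotient (Mumford's (2):
`𝒪_Y → π_*𝒪_X` is injective). [cite: MumfordAV1970, §7 Thm. p. 66 (2)] -/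
theorem injective_app_of_restrict (h : (ρ.restrict (p ⁻¹ᵁ W) hW).IsGeometricQuotient (p ∣_ W)) :
    Function.Injective (p.app W) :=
  (ρ.injective_app_and_range_app_of_restrict W hW h).1

/-- The image of `p♯` over a chart on which `p` restricts to a geometric quotient is the ring of
invariants. [cite: MumfordAV1970, §7 Thm. p. 66 (2)] -/
theorem range_app_of_restrict (h : (ρ.restrict (p ⁻¹ᵁ W) hW).IsGeometricQuotient (p ∣_ W)) :
    Set.range (p.app W) =
      {s | ∀ g : G, (ρ.aut g⁻¹).hom.appLE (p ⁻¹ᵁ W) (p ⁻¹ᵁ W) (hW g⁻¹).ge s = s} :=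
  (ρ.injective_app_and_range_app_of_restrict W hW h).2

end Sections

/-- **Locality over an affine cover, for affine `p`.** A `G`-invariant AFFINE morphism `p : X → Q`
which restricts to a geometric quotient over each member of an affine open cover of `Q` is a
geometric quotient. [cite: MumfordAV1970, §7 Thm. p. 66] -/
theorem isGeometricQuotient_of_restrict [Finite G] [IsAffineHom p] {Y : Scheme.{u}} {r : X ⟶ Y}
    (ρ : ActionOver r G) (hp : ∀ g : G, (ρ.aut g).hom ≫ p = p) {ι : Type*} (U : ι → Q.affineOpens)
    (hU : ⨆ i, (U i : Q.Opens) = ⊤)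
    (h : ∀ i, (ρ.restrict (p ⁻¹ᵁ (U i).1) (fun g => by rw [← Scheme.Hom.comp_preimage, hp])).IsGeometricQuotient
      (p ∣_ (U i).1)) :
    ρ.IsGeometricQuotient p := by
  rw [← ρ.isGeometricQuotient_overMap_iff p hp]
  exact (⟨ρ.aut, hp⟩ : ActionOver p G).isGeometricQuotient_of_range_app U hU
    (fun i => ρ.injective_app_of_restrict (U i).1 _ (h i)) (fun i => ρ.range_app_of_restrict (U i).1 _ (h i))

end ActionOver

/-! ### The glued quotient `X → X/G` is a geometric quotient -/

namespace ActionOver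

variable {X Y : Scheme.{u}} {r : X ⟶ Y} {G : Type*} [Group G] (ρ : ActionOver r G)
  [Finite G] [Y.IsSeparated] [IsSeparated r] (hcov : ∀ x : X, ∃ O : ρ.StableAffineOpens, x ∈ O.1)

set_option backward.isDefEq.respectTransparency false

/-- `π⁻¹(O/G)` is `G`-stable (it is the `G`-stable affine open `O`, Mumford's `U_α`). [cite: MumfordAV1970, §7 Thm. p. 66 (proof)] -/
theorem aut_preimage_gluedMk_preimage (g : G) (V : ρ.glued.Opens) :
    (ρ.aut g).hom ⁻¹ᵁ (ρ.gluedMk hcov ⁻¹ᵁ V) = ρ.gluedMk hcov ⁻¹ᵁ V := by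
  rw [← Scheme.Hom.comp_preimage, aut_hom_gluedMk]

/-- **Over each chart `O/G ⊆ X/G`, the glued quotient map `π` is a geometric quotient**: there
`π|_{π⁻¹(O/G)}` is `O → O/G` (`isGeometricQuotient_toQuotient` for the restricted action) transported
along `O/G ≅ chart` and `π⁻¹(O/G) = O`. [cite: MumfordAV1970, §7 Thm. p. 66] -/
theorem isGeometricQuotient_morphismRestrict_gluedMk (O : ρ.StableAffineOpens) :
    (ρ.restrict (ρ.gluedMk hcov ⁻¹ᵁ (ρ.gluedι O).opensRange)
        (fun g => ρ.aut_preimage_gluedMk_preimage hcov g _)).IsGeometricQuotient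
      (ρ.gluedMk hcov ∣_ (ρ.gluedι O).opensRange) := by
  have hpre : ρ.gluedMk hcov ⁻¹ᵁ (ρ.gluedι O).opensRange = O.1 := ρ.preimage_opensRange_gluedι hcov O
  -- `O → O/G ≅ chart`
  have h₁ := ((ρ.restrict O.1 O.2.1).isGeometricQuotient_toQuotient).of_isoTarget (ρ.gluedι O).isoOpensRange
  -- the source isomorphism `π⁻¹(O/G) ≅ O`
  let j : (↑(ρ.gluedMk hcov ⁻¹ᵁ (ρ.gluedι O).opensRange) : Scheme.{u}) ≅ ↑O.1 := X.isoOfEq hpre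
  have hj : ∀ g : G, j.hom ≫ ((ρ.restrict O.1 O.2.1).aut g).hom =
      ((ρ.restrict (ρ.gluedMk hcov ⁻¹ᵁ (ρ.gluedι O).opensRange)
        (fun g => ρ.aut_preimage_gluedMk_preimage hcov g _)).aut g).hom ≫ j.hom := by
    intro g
    rw [restrict_aut_hom, restrict_aut_hom, ← cancel_mono O.1.ι, Category.assoc, Category.assoc,
      restrictHom_ι, Scheme.isoOfEq_hom_ι_assoc, Scheme.isoOfEq_hom_ι, restrictHom_ι]
  have h₂ := IsGeometricQuotient.of_equivariantIso _ j hj h₁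
  have e : j.hom ≫ (ρ.restrict O.1 O.2.1).toQuotient ≫ (ρ.gluedι O).isoOpensRange.hom =
      ρ.gluedMk hcov ∣_ (ρ.gluedι O).opensRange := by
    rw [← cancel_mono (ρ.gluedι O).opensRange.ι, Category.assoc, Category.assoc,
      Scheme.Hom.isoOpensRange_hom_ι, morphismRestrict_ι]
    change j.hom ≫ ρ.pieceMk O ≫ ρ.gluedι O = _
    rw [← ρ.ι_gluedMk hcov O, Scheme.isoOfEq_hom_ι_assoc]
  rwa [e] at h₂

/-- The charts `O/G` cover `X/G` ("we glue the `V_α`"). [cite: MumfordAV1970, §7 Thm. p. 66 (proof)] -/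
theorem iSup_opensRange_gluedι : ⨆ O : ρ.StableAffineOpens, (ρ.gluedι O).opensRange = ⊤ := by
  rw [eq_top_iff]
  rintro z -
  obtain ⟨O, q, rfl⟩ := ρ.gluedι_jointly_surjective z
  exact TopologicalSpace.Opens.mem_iSup.mpr ⟨O, q, rfl⟩

variable [IsAffine Y]

/-- Over an affine base, the charts `O/G ⊆ X/G` are affine opens (Mumford's `V_α ⊆ Y`).
[cite: MumfordAV1970, §7 Thm. p. 66 (proof)] -/
theorem isAffineOpen_opensRange_gluedι (O : ρ.StableAffineOpens) :
    IsAffineOpen (ρ.gluedι O).opensRange :=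
  haveI := ρ.isAffine_pieceQuot O
  isAffineOpen_opensRange _

/-- **The glued quotient map `π : X → X/G` is a geometric quotient** (Mumford, AV §7 Thm. p. 66,
conditions (1) and (2), for the glued `X/G` over an AFFINE base `Y`, e.g. a field): `π` is affine,
`G`-invariant, and a geometric quotient over each (affine) chart `O/G`, hence one globally
(`isGeometricQuotient_of_restrict`). In particular `Γ(X/G, W) = Γ(X, π⁻¹W)^G` for EVERY open `W`
(`IsGeometricQuotient.range_app`) and `π♯` is injective. [cite: MumfordAV1970, §7 Thm. p. 66 (1), (2)] -/
theorem isGeometricQuotient_gluedMk : ρ.IsGeometricQuotient (ρ.gluedMk hcov) :=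
  ρ.isGeometricQuotient_of_restrict (ρ.aut_hom_gluedMk hcov)
    (fun O : ρ.StableAffineOpens => ⟨(ρ.gluedι O).opensRange, ρ.isAffineOpen_opensRange_gluedι O⟩)
    ρ.iSup_opensRange_gluedι (fun O => ρ.isGeometricQuotient_morphismRestrict_gluedMk hcov O)

end ActionOver

end Literature.AlgebraicGeometry.RelativeSpec

end
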